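import Literature.AlgebraicGeometry.ComplexMultiplication.ShimuraIsogenousPowerHolds
import Literature.AlgebraicGeometry.ComplexMultiplication.CMAlgebraAbelianVarietyStablyNondegenerateReducedModel
import Literature.AlgebraicGeometry.ComplexMultiplication.PrimitiveCMTypeSimple
import Literature.AlgebraicGeometry.ComplexMultiplication.CMTypeRealisationIsogenyTransport
import Literature.NumberTheory.ComplexMultiplication.CMDefinedOverQbarHolds
import Literature.NumberTheory.ComplexMultiplication.MainTheoremCMLevelCommonField
import Literature.AlgebraicGeometry.Motives.AbelianVarietyNumberFieldDescent
import Literature.AlgebraicGeometry.Motives.AbelianVarietyHomRationalCommonFieldPair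
import Literature.AlgebraicGeometry.Motives.TateAbelianFiniteLatticeProofs
import Literature.AlgebraicGeometry.Motives.AbelianVarietyIdempotentRelations
import Mathlib.CategoryTheory.Preadditive.AdditiveFunctor
import HarnessLib

/-!
# Every CM structure becomes isogenous, over a finite normal extension, to a power of a structure of its
# PRIMITIVE core type (Shimura 1998, §6.2 Thm. 3 with §8.2 Prop. 26 and §12.4 Prop. 26; [Fal83] §5 ¶1)

Topic `Literature/NumberTheory/ComplexMultiplication`, namespace `Literature.NumberTheory.ComplexMultiplication`.
THEOREMS ONLY (no definition, no named fact, no instance; net Literature debt 0).  Cell `hodgecm-mathlib`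
(D-0151), T5 distance ledger, item (N7a): the reusable `∃`-package that lets the Faltings–Tate bricks for CM
structures of PRIMITIVE type (`FaltingsTateOfPrimitiveCM`, (N2)) reach EVERY CM structure.

THE STATEMENT (`IsCMTypeRealisationOver.exists_isIsogenous_biproduct_primitive`).  Let `(A₀, ι₀)` be a
structure of CM type `(K, Φ)` over a number field `k ⊂ ℂ` (`IsCMTypeRealisationOver Φ A₀ ι₀`), `K` a CM field,
`Φ` ANY CM type.  Then there are: the primitive core `(K₁, Φ₁)` of `Φ` (`K₁ ≤ K`, `Φ` induced from `Φ₁`, `K₁` a CM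
field, `Φ₁` primitive for `Aut(ℂ)` at every base point — Streng I Lemma 3.5 / [Shi98] §8.2 Prop. 26), a finite
NORMAL extension `E/k` inside `ℂ`, a structure `(B, ι_B)` of type `(K₁, Φ₁)` over `E`, and `h ≥ 1` with
`A₀ ⊗_k E` isogenous to `⨁_{Fin h} B` (both directions).

THE PROOF (every sentence is a ★ theorem of the tree; this file is the assembly).
1. Core: `exists_primitive_inducedCMType_eq_of_isShimuraCMType` (+ `isShimuraCMType_of_cmType`,
   `isPrimitive_ringEquiv_complex_iff`).
2. Over `ℂ` ([Shi98] §6.2 Thm. 3, second half): `Shimura1998_Thm3_isogenousPower_holds` — `A₀ ⊗ ℂ` (of the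
   induced type) is `𝓞_{K₁}`-isogenous onto a product `P = ∏_{Fin h} B` of a realisation `B` of `(K₁; Φ₁)`.
3. Descent of `B` ([Shi98] §12.4 Prop. 26): `shimura1998_prop26_definedOverQbar_holds` (model over `ℚ̄ ⊂ ℂ`)
   and `AbelianVariety.exists_numberField_descent_ringHom` (model `(B₂, ι₂)` over a number field `k₀ ⊂ ℚ̄`);
   the type is kept (`IsCMTypeRealisation.exists_iff_of_iso`).
4. Descent of the isogeny ([Shi98] §18.6 p. 127 (iv); [Mum] §19 Thm. 3):
   `exists_intermediateField_surjective_homBaseChange_pair A₀ (⨁ B₂)` gives ONE finite `L′ ⊂ ℂ` over `k` and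
   `k₀` over which all `ℂ`-homomorphisms between `A₀ ⊗ L′` and `(⨁ B₂) ⊗ L′` (both ways) are rational, so the
   `ℂ`-isogeny and a quasi-inverse descend (`IsIsogenous.of_surjective_homBaseChange`, §2).
5. Normal hull: `exists_intermediateField_normal_rat_le` (a finite `E ⊇ L′`, normal over `ℚ`, hence over `k`);
   base change `L′ → E` (`IsIsogenous.baseChange`, `IsCMTypeRealisationOver.baseChange`).

§1 is the product bookkeeping: a limit fan of `h` copies of `B` is the biproduct (`exists_iso_biproduct_of_isLimit_fan`),
and base change commutes with finite biproducts (`nonempty_baseChange_biproduct_iso`, from the tree's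
`(baseChangeFunctor K L).Additive`).

## References

* [Shimura1998] G. Shimura, *Abelian Varieties with Complex Multiplication and Modular Functions* (1998): §6.2
  Thm. 3 (pp. 42–44), §8.2 Prop. 26 (p. 61), §12.4 Prop. 26, §18.6 proof of Thm. 18.6 p. 127 (iv).
* [Faltings1983Endlichkeit] G. Faltings, Invent. Math. 73 (1983), §5 ¶1 («wir dürfen `K` durch eine endliche
  Erweiterung ersetzen»).
* [MumfordAV1970] D. Mumford, *Abelian Varieties* (1970), §19 Thm. 3 and Remark p. 169.
-/

noncomputable section

open CategoryTheory CategoryTheory.Limits NumberField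
open Literature.AlgebraicGeometry.Motives Literature.AlgebraicGeometry.Motives.AbelianVariety
open Literature.AlgebraicGeometry.ComplexMultiplication

universe u

namespace Literature.NumberTheory.ComplexMultiplication

/-! ## §1. Products: limit fans are biproducts; base change commutes with finite biproducts -/

section Products

variable {K : Type u} [Field K]

/-- A limit fan of finitely many abelian varieties is (isomorphic to) their biproduct, compatibly with the
projections. [folklore] -/
private theorem exists_iso_biproduct_of_isLimit_fan {J : Type} [Fintype J] (B : J → AbelianVariety K)
    (P : AbelianVariety K) (π : ∀ j, P ⟶ B j) (hP : IsLimit (Fan.mk P π)) :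
    ∃ e : P ≅ ⨁ B, ∀ j, e.hom ≫ biproduct.π B j = π j := by
  classical
  refine ⟨hP.conePointUniqueUpToIso (biproduct.isLimit B), fun j => ?_⟩
  exact hP.conePointUniqueUpToIso_hom_comp (biproduct.isLimit B) ⟨j⟩

variable (L : Type u) [Field L] [Algebra K L]

/-- **Base change commutes with finite biproducts of abelian varieties** (the base-change functor is additive,
the tree's `(baseChangeFunctor K L).Additive`; Mathlib `Functor.mapBiproduct`): `(⨁ B) ⊗ L ≅ ⨁ (B j ⊗ L)`.
[cite: MumfordAV1970, §19 (p. 176)] -/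
theorem nonempty_baseChange_biproduct_iso {J : Type} [Fintype J] (B : J → AbelianVariety K) :
    Nonempty ((⨁ B).baseChange L ≅ ⨁ fun j => (B j).baseChange L) :=
  ⟨(baseChangeFunctor K L).mapBiproduct B⟩

end Products

/-! ## §2. Descent of an isogeny along a common field of rationality -/

section IsogenyDescent

variable {K : Type u} [Field K] [CharZero K] (L : Type u) [Field L] [Algebra K L] {X Y : AbelianVariety K}

/-- **An isogeny over `L` between base changes descends when all homomorphisms both ways are rational over
`K`**: if `Hom.baseChange L` is onto on `(X ⟶ Y)` and on `(Y ⟶ X)` and `X ⊗ L`, `Y ⊗ L` are isogenous, then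
`X` and `Y` are isogenous over `K`, in both directions (the `L`-isogeny `g` and a quasi-inverse `g′` with
`g g′ = n = g′ g` come from `f`, `f′` over `K`; `f f′ = n = f′ f` by faithfulness of base change, so `f`, `f′`
are isogenies).  [Shi98] §18.6 p. 127 (iv) «all homomorphisms of `A_i` to `A_j` are rational over an algebraic
number field»; [Mum] §19 Remark p. 169. [cite: Shimura1998, §18.6 proof of Thm. 18.6, p. 127 (iv)]
[cite: MumfordAV1970, §19 Thm. 3 and Remark p. 169] -/
theorem _root_.Literature.AlgebraicGeometry.Motives.AbelianVariety.IsIsogenous.of_surjective_homBaseChange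
    (hXY : Function.Surjective (Hom.baseChange L : (X ⟶ Y) → (X.baseChange L ⟶ Y.baseChange L)))
    (hYX : Function.Surjective (Hom.baseChange L : (Y ⟶ X) → (Y.baseChange L ⟶ X.baseChange L)))
    (h : IsIsogenous (X.baseChange L) (Y.baseChange L)) : IsIsogenous X Y ∧ IsIsogenous Y X := by
  obtain ⟨g, hg⟩ := h
  obtain ⟨g', n, hn, hgg', hg'g⟩ := IsIsogeny.exists_nsmul_inverse_holds hg
  obtain ⟨f, rfl⟩ := hXY g
  obtain ⟨f', rfl⟩ := hYX g'
  have hnK : ((n : ℕ) : K) ≠ 0 := Nat.cast_ne_zero.2 hn.ne'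
  have hn1 : ∀ Z : AbelianVariety K, Hom.baseChange L (n • 𝟙 Z) = n • 𝟙 (Z.baseChange L) := fun Z => by
    change (baseChangeFunctor K L).map (n • 𝟙 Z) = n • 𝟙 ((baseChangeFunctor K L).obj Z)
    rw [CategoryTheory.Functor.map_nsmul, CategoryTheory.Functor.map_id]
  have hff' : f ≫ f' = n • 𝟙 X := by
    apply Hom.baseChange_injective L
    rw [Hom.baseChange_comp, hgg', hn1]
  have hf'f : f' ≫ f = n • 𝟙 Y := by
    apply Hom.baseChange_injective L
    rw [Hom.baseChange_comp, hg'g, hn1]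
  exact ⟨⟨f, isIsogeny_of_comp_eq_of_comp_eq (isIsogeny_nsmul_id_of_cast_ne_zero Y n hnK)
      (isIsogeny_nsmul_id_of_cast_ne_zero X n hnK) hf'f hff'⟩,
    ⟨f', isIsogeny_of_comp_eq_of_comp_eq (isIsogeny_nsmul_id_of_cast_ne_zero X n hnK)
      (isIsogeny_nsmul_id_of_cast_ne_zero Y n hnK) hff' hf'f⟩⟩

omit [CharZero K] in
/-- Isogeny classes are invariant under isomorphism of the two ends. [folklore] -/
private theorem isIsogenous_of_iso_of_iso {X' Y' : AbelianVariety K} (h : IsIsogenous X Y) (eX : X ≅ X')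
    (eY : Y ≅ Y') : IsIsogenous X' Y' := by
  obtain ⟨f, hf⟩ := h
  exact ⟨eX.inv ≫ f ≫ eY.hom, isIsogeny_comp (IsIsogeny.of_iso eX.symm) (isIsogeny_comp hf (IsIsogeny.of_iso eY))⟩

end IsogenyDescent

/-! ## §3. The theorem -/

section Main

variable {k : Type} [Field k] [NumberField k] [Algebra k ℂ] {K : Type} [Field K] [NumberField K] [IsCMField K]
  {Φ : CMType K} {A₀ : AbelianVariety k} {ι₀ : 𝓞 K →+* End A₀}

/-- **EVERY CM STRUCTURE IS, OVER A FINITE NORMAL EXTENSION, ISOGENOUS TO A POWER OF A STRUCTURE OF ITS PRIMITIVE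
CORE TYPE** ([Shi98] §6.2 Thm. 3 «if `F` does not coincide with `K`, `A` is not simple» with its proof «`ℂⁿ/D(𝔪)`
is … isomorphic to the direct product of `h` copies of `ℂ^m/Δ`», §8.2 Prop. 26, §12.4 Prop. 26 «defined over an
algebraic number field of finite degree», §18.6 p. 127 (iv); [Fal83] §5 ¶1).  For a structure `(A₀, ι₀)` of type
`(K, Φ)` over a number field `k ⊂ ℂ`: there are the primitive core `(K₁, Φ₁)` of `Φ` (`K₁` CM, `Φ = Φ₁^K`, `Φ₁`
primitive for `Aut(ℂ)` at every base point), a finite normal `E/k` inside `ℂ`, a structure `(B, ι_B)` of type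
`(K₁, Φ₁)` over `E` and `h ≥ 1` with `⨁_{Fin h} B ∼ A₀ ⊗_k E` and `A₀ ⊗_k E ∼ ⨁_{Fin h} B`.  The `∃`-package is shaped
for the tree's (N2) heads (`FaltingsTateOfPrimitiveCM`) and for `faltings_tate_bijective_of_baseChange_end (E := E)`.
[cite: Shimura1998, §6.2 Thm. 3 (pp. 42–44); §8.2 Prop. 26 (p. 61); §12.4 Prop. 26; §18.6 p. 127 (iv)]
[cite: Faltings1983Endlichkeit, §5 ¶1] -/
theorem IsCMTypeRealisationOver.exists_isIsogenous_biproduct_primitive (hA : IsCMTypeRealisationOver Φ A₀ ι₀) :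
    ∃ (K₁ : IntermediateField ℚ K) (Φ₁ : CMType K₁), IsCMField K₁ ∧
      inducedCMType (algebraMap K₁ K) Φ₁ = Φ ∧ (∀ φ₀ : K₁ →+* ℂ, IsPrimitive (ℂ ≃+* ℂ) Φ₁.1 φ₀) ∧
      ∃ (E : IntermediateField k ℂ), FiniteDimensional k E ∧ Normal k E ∧
        ∃ (B : AbelianVariety E) (ιB : 𝓞 K₁ →+* End B), IsCMTypeRealisationOver Φ₁ B ιB ∧
          ∃ h : ℕ, 0 < h ∧ (⨁ fun _ : Fin h => B).IsIsogenous (A₀.baseChange E) ∧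
            (A₀.baseChange E).IsIsogenous (⨁ fun _ : Fin h => B) := by
  classical
  -- Step 1: the primitive core
  obtain ⟨K₁, Φ₁, hCM₁, hΦ, hsep, -⟩ :=
    exists_primitive_inducedCMType_eq_of_isShimuraCMType Φ (isShimuraCMType_of_cmType Φ)
  haveI : IsCMField K₁ := hCM₁
  have hprim : ∀ φ₀ : K₁ →+* ℂ, IsPrimitive (ℂ ≃+* ℂ) Φ₁.1 φ₀ := fun φ₀ =>
    (isPrimitive_ringEquiv_complex_iff Φ₁ φ₀).2 hsep
  -- Step 2: over `ℂ`, `A₀ ⊗ ℂ` is isogenous onto a product of copies of a realisation `B` of the core type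
  obtain ⟨θ, hθ⟩ := hA
  rw [← hΦ] at hθ
  obtain ⟨B, ιB, θB, hB, h, P, π, ⟨hP⟩, g, hg, hgequiv⟩ :=
    Shimura1998_Thm3_isogenousPower_holds K₁ K (algebraMap K₁ K : K₁ →+* K) Φ₁ (A₀.baseChange ℂ)
      ((A₀.endBaseChange ℂ).comp ι₀) θ hθ
  -- `0 < h`: `dim (A₀ ⊗ ℂ) = dim P = h · dim B` and `2 dim (A₀ ⊗ ℂ) = [K : ℚ] > 0`
  obtain ⟨eP, heP⟩ := exists_iso_biproduct_of_isLimit_fan (fun _ : Fin h => B) P π hP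
  have hhpos : 0 < h := by
    by_contra h0
    have h0' : h = 0 := by omega
    subst h0'
    have hdimP : P.dim = 0 := by
      rw [dim_eq_of_isIsogeny (IsIsogeny.of_iso eP), dim_biproduct]
      simp
    have hdimA : (A₀.baseChange ℂ).dim = 0 := by rw [dim_eq_of_isIsogeny hg, hdimP]
    have hK : Module.finrank ℚ K = 2 * (A₀.baseChange ℂ).dim := Literature.AlgebraicGeometry.Pohlmann1968.finrank_eq_two_mul_dim_of_isCMTypeRealisation hθ
    rw [hdimA, mul_zero] at hK
    exact Module.finrank_pos.ne' hK
  -- Step 3: a model `(B₂, ι₂)` of `(B, ιB)` over a number field `k₀ ⊂ ℚ̄ ⊂ ℂ`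
  obtain ⟨B₁, ι₁, e₁, he₁⟩ := shimura1998_prop26_definedOverQbar_holds K₁ Φ₁ B ιB θB hB
  haveI : Algebra.IsAlgebraic ℚ (algebraicClosure ℚ ℂ) := algebraicClosure.isAlgebraic ℚ ℂ
  obtain ⟨k₀, hk₀, B₂, ι₂, e₂, he₂⟩ :=
    AbelianVariety.exists_numberField_descent_ringHom (algebraicClosure ℚ ℂ) B₁ ι₁
  haveI : NumberField k₀ := hk₀
  -- the `𝓞_{K₁}`-isomorphism `B₂ ⊗ ℂ ≅ B`
  let E₂ : B₂.baseChange ℂ ≅ B :=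
    (baseChangeTowerIso k₀ (algebraicClosure ℚ ℂ) ℂ B₂).symm ≪≫
      (baseChangeFunctor (algebraicClosure ℚ ℂ) ℂ).mapIso e₂ ≪≫ e₁
  have hE₂ : ∀ a : 𝓞 K₁, ((B₂.endBaseChange ℂ).comp ι₂) a ≫ E₂.hom = E₂.hom ≫ ιB a := by
    intro a
    change Hom.baseChange ℂ (ι₂ a : B₂ ⟶ B₂) ≫
      ((baseChangeTowerIso k₀ (algebraicClosure ℚ ℂ) ℂ B₂).inv ≫ Hom.baseChange ℂ e₂.hom ≫ e₁.hom) =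
      ((baseChangeTowerIso k₀ (algebraicClosure ℚ ℂ) ℂ B₂).inv ≫ Hom.baseChange ℂ e₂.hom ≫ e₁.hom) ≫ ιB a
    have h1 : Hom.baseChange ℂ (ι₂ a : B₂ ⟶ B₂) ≫ (baseChangeTowerIso k₀ (algebraicClosure ℚ ℂ) ℂ B₂).inv =
        (baseChangeTowerIso k₀ (algebraicClosure ℚ ℂ) ℂ B₂).inv ≫
          Hom.baseChange ℂ (Hom.baseChange (algebraicClosure ℚ ℂ) (ι₂ a : B₂ ⟶ B₂)) :=
      (baseChangeTowerIso_inv_comp_baseChange_baseChange (↥(algebraicClosure ℚ ℂ)) ℂ (ι₂ a : B₂ ⟶ B₂)).symm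
    have h2 : Hom.baseChange ℂ (Hom.baseChange (algebraicClosure ℚ ℂ) (ι₂ a : B₂ ⟶ B₂)) ≫
        Hom.baseChange ℂ e₂.hom = Hom.baseChange ℂ e₂.hom ≫ Hom.baseChange ℂ (ι₁ a : B₁ ⟶ B₁) := by
      rw [← Hom.baseChange_comp, he₂, Hom.baseChange_comp]
    rw [← Category.assoc, h1, Category.assoc, ← Category.assoc (Hom.baseChange ℂ (Hom.baseChange _ _)), h2,
      Category.assoc, he₁]
    simp only [Category.assoc]
  have hB₂ : IsCMTypeRealisationOver Φ₁ B₂ ι₂ :=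
    (IsCMTypeRealisation.exists_iff_of_iso E₂ hE₂).2 ⟨θB, hB⟩
  -- Step 4: `A₀ ⊗ ℂ ∼ (⨁_{Fin h} B₂) ⊗ ℂ`
  set B₀ : AbelianVariety k₀ := ⨁ fun _ : Fin h => B₂ with hB₀
  obtain ⟨eB₀⟩ := nonempty_baseChange_biproduct_iso ℂ (fun _ : Fin h => B₂)
  have hisoC : (A₀.baseChange ℂ).IsIsogenous (B₀.baseChange ℂ) := by
    refine isIsogenous_of_iso_of_iso ⟨g, hg⟩ (Iso.refl _) ?_
    exact eP ≪≫ biproduct.mapIso (fun _ : Fin h => E₂.symm) ≪≫ eB₀.symm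
  -- Step 5: a common finite field of rationality `L′ ⊂ ℂ` over `k` and `k₀`; descend the isogeny
  obtain ⟨L', hL'fd, instAlg, instTower, hsurj₁, hsurj₂⟩ :=
    exists_intermediateField_surjective_homBaseChange_pair A₀ B₀
  haveI := hL'fd
  letI := instAlg
  haveI := instTower
  have hisoL'C : ((A₀.baseChange L').baseChange ℂ).IsIsogenous ((B₀.baseChange L').baseChange ℂ) :=
    isIsogenous_of_iso_of_iso hisoC (baseChangeTowerIso k L' ℂ A₀).symm (baseChangeTowerIso k₀ L' ℂ B₀).symm
  obtain ⟨hisoL', hisoL'symm⟩ := IsIsogenous.of_surjective_homBaseChange ℂ hsurj₁ hsurj₂ hisoL'C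
  -- Step 6: a finite hull `E ⊇ L′` normal over `ℚ`, hence over `k`; base change `L′ → E`
  obtain ⟨E, hEfd, hEnormal, hle, -⟩ :=
    exists_intermediateField_normal_rat_le L' (⊥ : IntermediateField ℚ ℂ)
  haveI := hEfd
  haveI := hEnormal
  haveI : Normal k E := Normal.tower_top_of_normal ℚ k E
  letI : Algebra L' E := (IntermediateField.inclusion hle).toRingHom.toAlgebra
  haveI : IsScalarTower k L' E := IsScalarTower.of_algebraMap_eq fun _ => rfl
  haveI : IsScalarTower L' E ℂ := IsScalarTower.of_algebraMap_eq fun _ => rfl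
  letI : Algebra k₀ E := ((algebraMap L' E).comp (algebraMap k₀ L')).toAlgebra
  haveI : IsScalarTower k₀ L' E := IsScalarTower.of_algebraMap_eq fun _ => rfl
  haveI : IsScalarTower k₀ E ℂ := IsScalarTower.of_algebraMap_eq fun x => by
    change algebraMap k₀ ℂ x = algebraMap L' ℂ (algebraMap k₀ L' x)
    exact IsScalarTower.algebraMap_apply k₀ L' ℂ x
  obtain ⟨eBE⟩ := nonempty_baseChange_biproduct_iso E (fun _ : Fin h => B₂)
  have hAE : (A₀.baseChange E).IsIsogenous (⨁ fun _ : Fin h => B₂.baseChange E) :=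
    isIsogenous_of_iso_of_iso (hisoL'.baseChange E) (baseChangeTowerIso k L' E A₀)
      (baseChangeTowerIso k₀ L' E B₀ ≪≫ eBE)
  have hEA : (⨁ fun _ : Fin h => B₂.baseChange E).IsIsogenous (A₀.baseChange E) :=
    isIsogenous_of_iso_of_iso (hisoL'symm.baseChange E) (baseChangeTowerIso k₀ L' E B₀ ≪≫ eBE)
      (baseChangeTowerIso k L' E A₀)
  exact ⟨K₁, Φ₁, hCM₁, hΦ, hprim, E, hEfd, inferInstance, B₂.baseChange E, (B₂.endBaseChange E).comp ι₂,
    hB₂.baseChange, h, hhpos, hEA, hAE⟩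

end Main

end Literature.NumberTheory.ComplexMultiplication

end
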